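/-
Copyright (c) 2026 the pub-hodgecm-mathlib formalisation cell (harness21).  Prover seat hodgecm-mathlib-K2E4-p10 (g9), Track B «K2-LIT»,
#184♮ = hLiu418 = `stmt-HodgeConjecture-24832`; socket #41, KIND W, (x-b) of LEAD F0P6-plan (g14) BATCH #62 (1) + desk K2E5-p17 (g8) RULING 2026-09-04T22:15:21Z
(«(x-a) F0P2-p08: ∃-shaped continued `T`-part with a PER-PLACE PRESENTATION; (x-b) K2E4-p10: `hdec_of_local` ∕ `hsupp_of_local` hypothesis-first, ∃-packaging head LAST»).
THEOREMS ONLY (no `def`, no `instance`, no notation, no named-fact hypothesis, no `sorry`).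
-/
import Summits.HodgeConjecture.HodgeConjecture.Theorems.K2LiuGlobalDenominatorOfLocalBounds   -- ★ p862151 (this lineage, g8): `exists_den_of_valuation_le`, `cast_prod_absNorm_pow_le`
import Literature.NumberTheory.Automorphic.LeviEmbeddingGLHeight                              -- ★ `GLn.one_le_mul_archHeight_sq`, `GLn.hasFiniteMulSupport_localHeight` (+ ★ `AdelicHeightGLProofs`)
import Mathlib.Analysis.SpecialFunctions.Pow.Real
import HarnessLib

/-!
# Crux `HLiu418`, socket #41, KIND W — `K2LiuSiegelEisensteinKindWInstance`, §1: THE SUPPORT LETTER `hsupp` OF THE TOP FROM PER-PLACE LATTICE LETTERS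

Cell `hodgecm-mathlib`, crux item hLiu418 = `stmt-HodgeConjecture-24832` (helper lane `--supports … --as helper`, count-neutral), route of record `HCCMUnconditional`;
squad K2 ∕ K2Liu, road `K2_Liu`, socket #41 `sig_K2LiuSiegelEisensteinContinuation`, KIND W (the non-degenerate Fourier coefficients of the continued Siegel
Eisenstein series).  The TOP of record (★ ed. 15 `K2LiuSiegelEisensteinContinuationTopFifteen` :176–196) takes KIND W BY VALUE: a `T`-part
`A : Skew → ℂ → H(𝔸) → ℂ` with its Euler identity `hEuler`, holomorphy `hAd`, and the three analytic letters of this lineage (★ p862095 ∕ ★ p862151 ∕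
★ p861878 → ★ p861906 → ★ p861512): the archimedean size `τ` (`hτ`), the height-form Gaussian decay `hdec` (:190–192) and the bounded-denominator SUPPORT
letter `hsupp` (:193–196):
  `∀ S s h, 0 < re s → A S s h ≠ 0 → ∃ D : ℕ, 1 ≤ D ∧ (D : ℝ) ≤ C_W · ‖h‖^κ ∧ ∀ i j, IsIntegral ℤ (D · S_{ij})`.
By the desk ruling of record (K2E5-p17 (g8) 2026-09-04T22:15:21Z on this seat's abscissa note 22:14:59Z) `A` is the CONTINUED `T`-part, ∃-bound, with a
PER-PLACE PRESENTATION `A S s h = (∏_{w∣∞} F_{∞,w} S s h) · ∏_{v ∈ T(S,h)_fin} F_v S s h` over continued local Whittaker functions ((x-a), F0P2-p08 (g2)).  The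
local theory pays, PLACE BY PLACE, lattice letters of the shape «`F_v S s h ≠ 0` ⇒ for every `w ∣ v`, `|S_{ij}|_w ≤ q_w^{m_w}` with `q_w^{m_w} ≤ q_w^{δ_w} · H_w(h)^k`»
(`H_w` the local height of ★ `AdelicGLnGlue`, `δ_w` the level∕different defect at the finitely many bad places, `δ_w = 0` elsewhere; ★ Φ5 F4a
`K2LiuBadPlaceWhittakerShells.setIntegral_eq_zero_of_unipotent_translate`, ★ G3; at the places `v ∉ T(S,h)` the entries of `S` are `v`-integral by the very
definition of `T(S,h) ⊇ D(S)`, (x-a)'s `kindWPlaces`).  THIS FILE (§1) is the A-AGNOSTIC ASSEMBLY «per-place lattice letters ⟹ `hsupp` in the TOP's bytes»: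
the denominator `D = ∏_w N(𝔭_w)^{m_w}` of ★ p862151 `exists_den_of_valuation_le` is bounded by `(∏_{w ∈ T_δ} N(𝔭_w)^{δ_w}) · (∏_w H_w(h))^k ≤ C_δ · (N‖h‖)^k`
(★ `GLn.one_le_mul_archHeight_sq`: `∏_w H_w ≤ N·‖h‖`; `H_w = 1` off a finite set, ★ `GLn.hasFiniteMulSupport_localHeight`).
* §1.1 height bookkeeping: `finprod_localHeight_le`, `pow_eq_zero_of_pow_absNorm_le_one` (`N(𝔭)^m ≤ 1 ⇒ m = 0`);
* §1.2 **`exists_den_of_local_letters`** — ONE index `S`, ONE point `g ∈ GL_N(𝔸_L)`: per-place letters ⟹ `∃ D, 1 ≤ D ∧ D ≤ C_δ N^k ‖g‖^k ∧ D·S ∈ M_n(𝓞)`;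
* §1.3 **`hsupp_of_local`** — THE TOP's SHAPE, generic in the index type `ι` (read: `skewMatrices …`, `mat := (↑)`) and the point type `X` (read: `HA …`,
  `ht := (↑)`, `N := n + n`): `∃ C_W κ, 0 < C_W ∧ 0 ≤ κ ∧ ∀ i s x, 0 < re s → A i s x ≠ 0 → ∃ D : ℕ, 1 ≤ D ∧ (D : ℝ) ≤ C_W · ‖ht x‖^κ ∧ ∀ a b, IsIntegral ℤ (D · (mat i) a b)`.
[MoeglinWaldspurger1995, I.2.2, II.1.7], [Shimura1997, §18.4 Prop. 18.14, §A6], [BorelJacquet1979, §1.2], [NeukirchANT1999, Ch. I §3, Ch. II §3].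
HONEST LABEL.  Count-neutral helper, closes no socket: `HC_CM` is proved only modulo the 7 printed citations (2 remaining named inputs: hLiu418 =
`stmt-HodgeConjecture-24832`, h413 = `stmt-HodgeConjecture-24833`) until rung 0 closes.
-/

set_option autoImplicit false
set_option linter.dupNamespace false -- the mandated namespace repeats `HodgeConjecture.HodgeConjecture`

noncomputable section

namespace Summit.HodgeConjecture.HodgeConjecture.Cruxes.HLiu418.K2LiuSiegelEisensteinKindWInstance

open scoped BigOperators NNReal
open NumberField IsDedekindDomain
open Literature.NumberTheory.Automorphic
open Summit.HodgeConjecture.HodgeConjecture.Cruxes.HLiu418.K2LiuGlobalDenominatorOfLocalBounds (exists_den_of_valuation_le cast_prod_absNorm_pow_le)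

variable (L : Type) [Field L] [NumberField L]

/-! ## §1.1 Height bookkeeping -/

section Height

variable {N : ℕ} [NeZero N]

/-- **`∏_w H_w(g) ≤ N · ‖g‖`** on `GL_N(𝔸_L)` (`N ≥ 1`): `‖g‖ = H_∞(g) · ∏_w H_w(g)` with `1 ≤ N · H_∞(g)²`, hence `1 ≤ N · H_∞(g)` (`H_∞ ≥ 1` or `H_∞² ≤ H_∞`).
[cite: BorelJacquet1979, §1.2] [cite: MoeglinWaldspurger1995, I.2.2] -/
theorem finprod_localHeight_le (g : GL (Fin N) (AdeleRing (𝓞 L) L)) :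
    ∏ᶠ w, (GLn.localHeight N L w g : ℝ) ≤ N * adelicHeightGL N L g := by
  have hsq := GLn.one_le_mul_archHeight_sq (K := L) g
  have hN : (1 : ℝ) ≤ N := by exact_mod_cast Nat.one_le_iff_ne_zero.2 (NeZero.ne N)
  have hH : 0 ≤ (GLn.archHeight N L g : ℝ) := NNReal.coe_nonneg _
  have hf : 0 ≤ ∏ᶠ w, (GLn.localHeight N L w g : ℝ) := finprod_nonneg fun _ => NNReal.coe_nonneg _
  have h1 : (1 : ℝ) ≤ N * (GLn.archHeight N L g : ℝ) := by
    by_cases hle : 1 ≤ (GLn.archHeight N L g : ℝ)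
    · calc (1 : ℝ) = 1 * 1 := (mul_one 1).symm
        _ ≤ N * (GLn.archHeight N L g : ℝ) := mul_le_mul hN hle zero_le_one (zero_le_one.trans hN)
    · have hlt : (GLn.archHeight N L g : ℝ) ≤ 1 := (not_le.1 hle).le
      calc (1 : ℝ) ≤ N * (GLn.archHeight N L g : ℝ) ^ 2 := hsq
        _ ≤ N * (GLn.archHeight N L g : ℝ) := by
            rw [sq]
            exact mul_le_mul_of_nonneg_left (mul_le_of_le_one_left hH hlt) (zero_le_one.trans hN)
  calc ∏ᶠ w, (GLn.localHeight N L w g : ℝ) = 1 * ∏ᶠ w, (GLn.localHeight N L w g : ℝ) := (one_mul _).symm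
    _ ≤ (N * (GLn.archHeight N L g : ℝ)) * ∏ᶠ w, (GLn.localHeight N L w g : ℝ) := mul_le_mul_of_nonneg_right h1 hf
    _ = N * adelicHeightGL N L g := by rw [adelicHeightGL, mul_assoc]

/-- **`(∏_w H_w(g))^k ≤ N^k · ‖g‖^k`** — the `k`-th power of `finprod_localHeight_le`, with the real power `‖g‖^(k : ℝ)` the TOP's letter is written in.
[cite: BorelJacquet1979, §1.2] -/
theorem finprod_localHeight_pow_le (g : GL (Fin N) (AdeleRing (𝓞 L) L)) (k : ℕ) :
    (∏ᶠ w, (GLn.localHeight N L w g : ℝ)) ^ k ≤ (N : ℝ) ^ k * adelicHeightGL N L g ^ (k : ℝ) := by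
  rw [Real.rpow_natCast, ← mul_pow]
  exact pow_le_pow_left₀ (finprod_nonneg fun _ => NNReal.coe_nonneg _) (finprod_localHeight_le L g) k

end Height

omit [NumberField L] in
/-- `N(𝔭_w) ≥ 2` for a non-zero prime `𝔭_w` of a Dedekind domain with finite quotients: `N(𝔭) ≠ 0` (`𝔭 ≠ ⊥`) and `N(𝔭) ≠ 1` (`𝔭 ≠ ⊤`).
[cite: NeukirchANT1999, Ch. I §3] -/
theorem two_le_absNorm [NumberField L] (w : HeightOneSpectrum (𝓞 L)) : 2 ≤ Ideal.absNorm w.asIdeal := by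
  have h0 : Ideal.absNorm w.asIdeal ≠ 0 := by rw [Ne, Ideal.absNorm_eq_zero_iff]; exact w.ne_bot
  have h1 : Ideal.absNorm w.asIdeal ≠ 1 := by rw [Ne, Ideal.absNorm_eq_one_iff]; exact w.isPrime.ne_top
  omega

/-- **`N(𝔭_w)^m ≤ 1 ⇒ m = 0`** (`N(𝔭_w) ≥ 2`): the exponent of a lattice letter vanishes wherever its bound is trivial. [cite: NeukirchANT1999, Ch. I §3] -/
theorem eq_zero_of_pow_absNorm_le_one (w : HeightOneSpectrum (𝓞 L)) {m : ℕ} (hm : ((Ideal.absNorm w.asIdeal : ℕ) : ℝ) ^ m ≤ 1) : m = 0 := by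
  by_contra hne
  have h2 : (2 : ℝ) ≤ ((Ideal.absNorm w.asIdeal : ℕ) : ℝ) := by exact_mod_cast two_le_absNorm L w
  have hlt : (1 : ℝ) < ((Ideal.absNorm w.asIdeal : ℕ) : ℝ) ^ m := one_lt_pow₀ (by linarith) hne
  exact absurd hm (not_le.2 hlt)

/-! ## §1.2 One index, one point: per-place lattice letters ⟹ a global denominator bounded by the height -/

section Den

variable {N : ℕ} [NeZero N] {n : ℕ}

/-- **PER-PLACE LATTICE LETTERS ⟹ A GLOBAL DENOMINATOR BOUNDED BY THE HEIGHT.**  `S ∈ M_n(L)`, `g ∈ GL_N(𝔸_L)` (`N ≥ 1`); a finite set `T_δ` of places of `L` with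
defects `δ_w ∈ ℕ` (`δ = 0` off `T_δ`) and an exponent `k ∈ ℕ`.  IF at every finite place `w` of `L` there is `m ∈ ℕ` with `N(𝔭_w)^m ≤ N(𝔭_w)^{δ_w} · H_w(g)^k` and
`|S_{ij}|_w ≤ q_w^{m}` for all `i, j` (the place-`w` lattice letter), THEN `∃ D : ℕ, 1 ≤ D ∧ D ≤ (∏_{w∈T_δ} N(𝔭_w)^{δ_w}) · N^k · ‖g‖^k ∧ ∀ i j, IsIntegral ℤ (D · S_{ij})`.
Proof: `m_w = 0` off `T := T_δ ∪ {w : H_w(g) ≠ 1}` (there `N(𝔭_w)^{m_w} ≤ 1`); ★ p862151 `exists_den_of_valuation_le` with `D = ∏_{w∈T} N(𝔭_w)^{m_w}` and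
`∏_{w∈T} N(𝔭_w)^{m_w} ≤ ∏_{w∈T} N(𝔭_w)^{δ_w} H_w^k = (∏_{w∈T_δ} N(𝔭_w)^{δ_w}) · (∏_w H_w(g))^k ≤ C_δ · N^k · ‖g‖^k` (`finprod_localHeight_pow_le`).
[cite: NeukirchANT1999, Ch. II §3] [cite: BorelJacquet1979, §1.2] [cite: Shimura1997, §18.4 Prop. 18.14] -/
theorem exists_den_of_local_letters (S : Matrix (Fin n) (Fin n) L) (g : GL (Fin N) (AdeleRing (𝓞 L) L))
    (Tδ : Finset (HeightOneSpectrum (𝓞 L))) (δ : HeightOneSpectrum (𝓞 L) → ℕ) (hδ : ∀ w ∉ Tδ, δ w = 0) (k : ℕ)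
    (hloc : ∀ w : HeightOneSpectrum (𝓞 L), ∃ m : ℕ,
      ((Ideal.absNorm w.asIdeal : ℕ) : ℝ) ^ m ≤ ((Ideal.absNorm w.asIdeal : ℕ) : ℝ) ^ δ w * (GLn.localHeight N L w g : ℝ) ^ k ∧
        ∀ i j, Valued.v (((S i j : L)) : w.adicCompletion L) ≤ WithZero.exp (m : ℤ)) :
    ∃ D : ℕ, 1 ≤ D ∧ (D : ℝ) ≤ (∏ w ∈ Tδ, ((Ideal.absNorm w.asIdeal : ℕ) : ℝ) ^ δ w) * (N : ℝ) ^ k * adelicHeightGL N L g ^ (k : ℝ) ∧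
      ∀ i j, IsIntegral ℤ ((D : L) * S i j) := by
  classical
  choose m hmle hmS using hloc
  -- the finite exceptional set `T = T_δ ∪ {H_w ≠ 1}`
  have hfin : Function.HasFiniteMulSupport fun w => (GLn.localHeight N L w g : ℝ) := GLn.hasFiniteMulSupport_localHeight g
  set T : Finset (HeightOneSpectrum (𝓞 L)) := Tδ ∪ hfin.toFinset with hT
  have hH1 : ∀ w ∉ T, (GLn.localHeight N L w g : ℝ) = 1 := fun w hw => by
    by_contra hne
    exact hw (Finset.mem_union_right _ (hfin.mem_toFinset.2 hne))
  have hm0 : ∀ w ∉ T, m w = 0 := fun w hw => by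
    refine eq_zero_of_pow_absNorm_le_one L w ((hmle w).trans ?_)
    rw [hδ w fun h => hw (Finset.mem_union_left _ h), pow_zero, hH1 w hw, one_pow, mul_one]
  -- the bound on `∏_{w∈T} N(𝔭_w)^{m_w}`
  have hq0 : ∀ w : HeightOneSpectrum (𝓞 L), (0 : ℝ) ≤ ((Ideal.absNorm w.asIdeal : ℕ) : ℝ) := fun w => Nat.cast_nonneg _
  have hHw0 : ∀ w, (0 : ℝ) ≤ (GLn.localHeight N L w g : ℝ) := fun w => NNReal.coe_nonneg _
  have hB : ((∏ w ∈ T, Ideal.absNorm w.asIdeal ^ m w : ℕ) : ℝ) ≤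
      (∏ w ∈ Tδ, ((Ideal.absNorm w.asIdeal : ℕ) : ℝ) ^ δ w) * (N : ℝ) ^ k * adelicHeightGL N L g ^ (k : ℝ) := by
    refine (cast_prod_absNorm_pow_le L T m (fun w => ((Ideal.absNorm w.asIdeal : ℕ) : ℝ) ^ δ w * (GLn.localHeight N L w g : ℝ) ^ k)
      fun w _ => hmle w).trans ?_
    rw [Finset.prod_mul_distrib, Finset.prod_pow]
    -- `∏_{w∈T} N(𝔭_w)^{δ_w} = ∏_{w∈T_δ} N(𝔭_w)^{δ_w}` and `∏_{w∈T} H_w = ∏ᶠ_w H_w`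
    have hδT : ∏ w ∈ T, ((Ideal.absNorm w.asIdeal : ℕ) : ℝ) ^ δ w = ∏ w ∈ Tδ, ((Ideal.absNorm w.asIdeal : ℕ) : ℝ) ^ δ w := by
      refine (Finset.prod_subset Finset.subset_union_left fun w _ hw => ?_).symm
      rw [hδ w hw, pow_zero]
    have hHT : ∏ w ∈ T, (GLn.localHeight N L w g : ℝ) = ∏ᶠ w, (GLn.localHeight N L w g : ℝ) := by
      refine (finprod_eq_prod_of_mulSupport_subset _ fun w hw => ?_).symm
      exact Finset.mem_coe.2 (Finset.mem_union_right _ (hfin.mem_toFinset.2 hw))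
    rw [hδT, hHT, mul_assoc]
    exact mul_le_mul_of_nonneg_left (finprod_localHeight_pow_le L g k) (Finset.prod_nonneg fun w _ => pow_nonneg (hq0 w) _)
  exact exists_den_of_valuation_le L S T m hm0 (fun i j w => hmS w i j) hB

end Den

/-! ## §1.3 The TOP's support letter `hsupp` from per-place lattice letters -/

section Supp

variable {N : ℕ} [NeZero N] {n : ℕ}

/-- **`hsupp` OF THE TOP FROM PER-PLACE LATTICE LETTERS** (★ ed. 15 :193–196 shape, generic in the index type `ι` — read `skewMatrices …` with `mat := (↑)` — and the
point type `X` — read `H(𝔸) = HA …` with `ht := (↑)`, `N := n + n`).  For a `T`-part `A : ι → ℂ → X → ℂ`, a finite defect datum `(T_δ, δ)` (`δ = 0` off `T_δ`) and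
`k ∈ ℕ`: IF `A i s x ≠ 0` (`0 < re s`) forces, at every finite place `w` of `L`, a lattice letter `|mat i|_w ≤ q_w^{m}` with `N(𝔭_w)^m ≤ N(𝔭_w)^{δ_w} · H_w(ht x)^k`,
THEN `∃ C_W κ, 0 < C_W ∧ 0 ≤ κ ∧ ∀ i s x, 0 < re s → A i s x ≠ 0 → ∃ D : ℕ, 1 ≤ D ∧ (D : ℝ) ≤ C_W · ‖ht x‖^κ ∧ ∀ a b, IsIntegral ℤ (D · (mat i) a b)`
with `C_W = (∏_{w∈T_δ} N(𝔭_w)^{δ_w}) · N^k`, `κ = k` (`exists_den_of_local_letters`).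
[cite: MoeglinWaldspurger1995, II.1.7] [cite: Shimura1997, §18.4 Prop. 18.14] [cite: BorelJacquet1979, §1.2] [cite: NeukirchANT1999, Ch. II §3] -/
theorem hsupp_of_local {ι X : Type*} (mat : ι → Matrix (Fin n) (Fin n) L) (ht : X → GL (Fin N) (AdeleRing (𝓞 L) L)) (A : ι → ℂ → X → ℂ)
    (Tδ : Finset (HeightOneSpectrum (𝓞 L))) (δ : HeightOneSpectrum (𝓞 L) → ℕ) (hδ : ∀ w ∉ Tδ, δ w = 0) (k : ℕ)
    (hloc : ∀ (i : ι) (s : ℂ) (x : X), 0 < s.re → A i s x ≠ 0 → ∀ w : HeightOneSpectrum (𝓞 L), ∃ m : ℕ,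
      ((Ideal.absNorm w.asIdeal : ℕ) : ℝ) ^ m ≤ ((Ideal.absNorm w.asIdeal : ℕ) : ℝ) ^ δ w * (GLn.localHeight N L w (ht x) : ℝ) ^ k ∧
        ∀ a b, Valued.v (((mat i a b : L)) : w.adicCompletion L) ≤ WithZero.exp (m : ℤ)) :
    ∃ CW κ : ℝ, 0 < CW ∧ 0 ≤ κ ∧ ∀ (i : ι) (s : ℂ) (x : X), 0 < s.re → A i s x ≠ 0 →
      ∃ D : ℕ, 1 ≤ D ∧ (D : ℝ) ≤ CW * adelicHeightGL N L (ht x) ^ κ ∧ ∀ a b, IsIntegral ℤ ((D : L) * mat i a b) := by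
  have hq0 : ∀ w : HeightOneSpectrum (𝓞 L), (0 : ℝ) < ((Ideal.absNorm w.asIdeal : ℕ) : ℝ) := fun w => by
    have h2 := two_le_absNorm L w
    exact_mod_cast (show 0 < Ideal.absNorm w.asIdeal by omega)
  have hN : (0 : ℝ) < N := by exact_mod_cast Nat.pos_of_ne_zero (NeZero.ne N)
  refine ⟨(∏ w ∈ Tδ, ((Ideal.absNorm w.asIdeal : ℕ) : ℝ) ^ δ w) * (N : ℝ) ^ k, k,
    mul_pos (Finset.prod_pos fun w _ => pow_pos (hq0 w) _) (pow_pos hN k), Nat.cast_nonneg k, fun i s x hs hA => ?_⟩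
  exact exists_den_of_local_letters L (mat i) (ht x) Tδ δ hδ k (hloc i s x hs hA)

end Supp

end Summit.HodgeConjecture.HodgeConjecture.Cruxes.HLiu418.K2LiuSiegelEisensteinKindWInstance

end
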